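import Summits.RiemannHypothesis.RiemannHypothesis.Theorems.ThetaTier1Arith
import HarnessLib

/-!
# THETA tier-1 kernel checker — the REGISTERS IN CLOSED FORM (arithmetic layer, reading aid for the analytic layer;
cc-s2-1, WEIL typing lane; RH-FREE bookkeeping)

`ThetaTier1Arith.lean` proves `checkAll rows = true → ∀ r ∈ rows, r.RealCert` with `r.loss = r.env 38`, `r.gain = r.env 39`,
where `Row.env` are the real registers of the straight-line program `Row.ins`.  This module unfolds the registers ONE STEP each,
so that the analytic layer (`r.RealCert → UC(r.q)`) can read every quantity of THETA-CERT-cc6 §D as an ordinary real expression: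

* generic register lemmas (`runR_of_lt`, `runR_getElem`, `runR_take_agree`, `varsBelow`/`eval_congr_below`,
  `Row.env_eq_eval`);
* the atom table `Row.env_atom` / `Row.vals_*` (registers `0 … 20` are `e^{1/2}, …, log 2, π, log 4π, e^{2δ}, …, log q, √q`);
* the twenty equations `Row.env_21 … Row.env_40` (`u₁ = e^{η′-δ}/√q`, `ζ* = 4πδq e^{2δ-η′}`, …, `loss = primesC + cross + arch + atom`,
  `gain = 2 I_lo log q`).

Nothing here bears on the truth of RH.
-/

set_option linter.dupNamespace false  -- the mandated namespace repeats `RiemannHypothesis`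
set_option autoImplicit false

namespace Summit.RiemannHypothesis.RiemannHypothesis.Theorems.ThetaTier1

open Literature.Analysis.ValidatedNumerics

/-! ## Generic register lemmas -/

/-- Registers below the start index are never written. [this cell] -/
theorem runR_of_lt : ∀ (es : List RExpr) (ρ : ℕ → ℝ) (n i : ℕ), i < n → runR es ρ n i = ρ i
  | [], ρ, n, i, _ => rfl
  | e :: es, ρ, n, i, h => by
      rw [runR, runR_of_lt es _ (n + 1) i (by omega)]
      simp [Nat.ne_of_lt h]

/-- Register `n + j` holds instruction `j` evaluated on the registers current at step `j`. [this cell] -/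
theorem runR_getElem : ∀ (es : List RExpr) (ρ : ℕ → ℝ) (n j : ℕ) (hj : j < es.length),
    runR es ρ n (n + j) = (es[j]'hj).eval (runR (es.take j) ρ n)
  | [], ρ, n, j, hj => absurd hj (by simp)
  | e :: es, ρ, n, 0, _ => by
      simp only [Nat.add_zero, runR, List.take_zero, List.getElem_cons_zero]
      rw [runR_of_lt es _ (n + 1) n (by omega)]
      simp
  | e :: es, ρ, n, j + 1, hj => by
      have hj' : j < es.length := by simpa using hj
      rw [runR, show n + (j + 1) = (n + 1) + j by omega, runR_getElem es _ (n + 1) j hj']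
      simp [runR]

/-- The registers at step `j` agree with the final registers below index `n + j`. [this cell] -/
theorem runR_take_agree : ∀ (es : List RExpr) (ρ : ℕ → ℝ) (n j i : ℕ), i < n + j →
    runR (es.take j) ρ n i = runR es ρ n i
  | [], ρ, n, j, i, _ => by simp [runR]
  | e :: es, ρ, n, 0, i, h => by
      rw [List.take_zero, runR_of_lt [] ρ n i (by omega), runR_of_lt (e :: es) ρ n i (by omega)]
  | e :: es, ρ, n, j + 1, i, h => by
      rw [List.take_succ_cons, runR, runR, runR_take_agree es _ (n + 1) j i (by omega)]

/-- All variable indices of a term are `< b`. [this cell] -/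
def varsBelow (b : ℕ) : RExpr → Bool
  | .const _ => true
  | .var i => decide (i < b)
  | .add e₁ e₂ => varsBelow b e₁ && varsBelow b e₂
  | .sub e₁ e₂ => varsBelow b e₁ && varsBelow b e₂
  | .mul e₁ e₂ => varsBelow b e₁ && varsBelow b e₂
  | .neg e => varsBelow b e
  | .sq e => varsBelow b e
  | .inv e => varsBelow b e
  | .abs e => varsBelow b e
  | .sqrt e => varsBelow b e
  | .min e₁ e₂ => varsBelow b e₁ && varsBelow b e₂
  | .max e₁ e₂ => varsBelow b e₁ && varsBelow b e₂

/-- A term reading only registers `< b` evaluates equally on environments agreeing below `b`. [this cell] -/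
theorem eval_congr_below {b : ℕ} {ρ ρ' : ℕ → ℝ} (h : ∀ i, i < b → ρ i = ρ' i) :
    ∀ e : RExpr, varsBelow b e = true → e.eval ρ = e.eval ρ'
  | .const _, _ => rfl
  | .var i, hv => by
      simp only [varsBelow, decide_eq_true_eq] at hv
      simpa [RExpr.eval] using h i hv
  | .add e₁ e₂, hv => by
      simp only [varsBelow, Bool.and_eq_true] at hv
      simp [RExpr.eval, eval_congr_below h e₁ hv.1, eval_congr_below h e₂ hv.2]
  | .sub e₁ e₂, hv => by
      simp only [varsBelow, Bool.and_eq_true] at hv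
      simp [RExpr.eval, eval_congr_below h e₁ hv.1, eval_congr_below h e₂ hv.2]
  | .mul e₁ e₂, hv => by
      simp only [varsBelow, Bool.and_eq_true] at hv
      simp [RExpr.eval, eval_congr_below h e₁ hv.1, eval_congr_below h e₂ hv.2]
  | .neg e, hv => by simp [RExpr.eval, eval_congr_below h e (by simpa [varsBelow] using hv)]
  | .sq e, hv => by simp [RExpr.eval, eval_congr_below h e (by simpa [varsBelow] using hv)]
  | .inv e, hv => by simp [RExpr.eval, eval_congr_below h e (by simpa [varsBelow] using hv)]
  | .abs e, hv => by simp [RExpr.eval, eval_congr_below h e (by simpa [varsBelow] using hv)]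
  | .sqrt e, hv => by simp [RExpr.eval, eval_congr_below h e (by simpa [varsBelow] using hv)]
  | .min e₁ e₂, hv => by
      simp only [varsBelow, Bool.and_eq_true] at hv
      simp [RExpr.eval, eval_congr_below h e₁ hv.1, eval_congr_below h e₂ hv.2]
  | .max e₁ e₂, hv => by
      simp only [varsBelow, Bool.and_eq_true] at hv
      simp [RExpr.eval, eval_congr_below h e₁ hv.1, eval_congr_below h e₂ hv.2]

/-- `rpow` reads what its base reads. [this cell] -/
theorem varsBelow_rpow {b : ℕ} {a : RExpr} (ha : varsBelow b a = true) (n : ℕ) : varsBelow b (rpow a n) = true := by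
  have hlin : ∀ k, varsBelow b (rpow.rpowLin a k) = true := by
    intro k
    induction k with
    | zero => rfl
    | succ k ih => simp [rpow.rpowLin, varsBelow, ih, ha]
  unfold rpow
  split_ifs <;> simp [varsBelow, ha, hlin]

/-- **A register equals its instruction evaluated on the FINAL registers**, provided the instruction reads only lower
registers. [this cell] -/
theorem Row.env_eq_eval (r : Row) (j : ℕ) (hj : j < r.ins.length) (hv : varsBelow (21 + j) (r.ins[j]'hj) = true) :
    r.env (21 + j) = (r.ins[j]'hj).eval r.env := by
  rw [Row.env, runR_getElem r.ins r.vals 21 j hj]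
  exact eval_congr_below (fun i hi => runR_take_agree r.ins r.vals 21 j i hi) _ hv

/-- The program has twenty instructions. [this cell] -/
theorem Row.length_ins (r : Row) : r.ins.length = 20 := rfl

/-! ## The atom registers -/

/-- Registers `0 … 20` are the atoms. [this cell] -/
theorem Row.env_atom (r : Row) {i : ℕ} (hi : i < 21) : r.env i = r.vals i := runR_of_lt _ _ _ _ hi

/-- The atom values, as a table. [this cell] -/
theorem Row.vals_table (r : Row) :
    r.vals 0 = Real.exp ((1 / 2 : ℚ) : ℝ) ∧ r.vals 1 = Real.exp ((-1 / 2 : ℚ) : ℝ) ∧ r.vals 2 = Real.exp ((-5 / 2 : ℚ) : ℝ) ∧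
    r.vals 3 = Real.exp ((-9 / 2 : ℚ) : ℝ) ∧ r.vals 4 = Real.exp ((-13 / 2 : ℚ) : ℝ) ∧ r.vals 5 = Real.exp ((-17 / 2 : ℚ) : ℝ) ∧
    r.vals 6 = Real.exp ((-21 / 2 : ℚ) : ℝ) ∧ r.vals 7 = Real.exp ((-25 / 2 : ℚ) : ℝ) ∧ r.vals 8 = Real.exp ((-2 : ℚ) : ℝ) ∧
    r.vals 9 = Real.log 2 ∧ r.vals 10 = Real.pi ∧ r.vals 11 = Real.log (4 * Real.pi) ∧
    r.vals 12 = Real.exp ((2 * r.delta : ℚ) : ℝ) ∧ r.vals 13 = Real.exp ((r.delta : ℚ) : ℝ) ∧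
    r.vals 14 = Real.exp ((2 * r.delta - ETA : ℚ) : ℝ) ∧ r.vals 15 = Real.exp ((ETA - r.delta : ℚ) : ℝ) ∧
    r.vals 16 = Real.exp ((-(r.m : ℚ) / (r.m + 1) : ℚ) : ℝ) ∧ r.vals 17 = Real.exp ((r.t0 / 2 : ℚ) : ℝ) ∧
    r.vals 18 = Real.exp ((r.m * (2 * r.delta - ETA) : ℚ) : ℝ) ∧ r.vals 19 = Real.log r.q ∧ r.vals 20 = Real.sqrt r.q := by
  simp [Row.vals, valOf, Row.atoms, constAtoms, Row.rowAtoms, Atom.val]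

/-! ## The twenty register equations (one THETA-CERT-cc6 §D quantity each) -/

section Registers
variable (r : Row)

/-- One register step: instruction `j`, named `e`, reading only lower registers. [this cell] -/
private theorem env_step (j : ℕ) (hj : j < 20) (e : RExpr) (he : r.ins[j]'(by rw [Row.length_ins]; exact hj) = e)
    (hv : varsBelow (21 + j) e = true) : r.env (21 + j) = e.eval r.env := by
  have := r.env_eq_eval j (by rw [Row.length_ins]; exact hj) (he ▸ hv)
  simpa [he] using this

/-- 21: `u₁ = e^{η′-δ}/√q`. [this cell, THETA-CERT-cc6 §D] -/
theorem Row.env_21 : r.env 21 = r.vals 15 * (r.vals 20)⁻¹ := by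
  rw [env_step r 0 (by norm_num) r.iU1 rfl rfl]
  simp [Row.iU1, rdiv, RExpr.eval, r.env_atom]

/-- 22: `ζ* = 4πδq · e^{2δ-η′}` (`(4δq) · (π · e^{2δ-η′})`). [this cell, THETA-CERT-cc6 D1] -/
theorem Row.env_22 : r.env 22 = ((4 * r.delta * r.q : ℚ) : ℝ) * (r.vals 10 * r.vals 14) := by
  rw [env_step r 1 (by norm_num) r.iZeta rfl rfl]
  simp [Row.iZeta, RExpr.eval, r.env_atom]

/-- 23: `m/ζ*`. [this cell, THETA-CERT-cc6 D1] -/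
theorem Row.env_23 : r.env 23 = ((r.m : ℚ) : ℝ) * (r.env 22)⁻¹ := by
  rw [env_step r 2 (by norm_num) r.iMZ rfl rfl]
  simp [Row.iMZ, rdiv, RExpr.eval]

/-- 24: `(m/ζ*)^m`. [this cell, THETA-CERT-cc6 D1] -/
theorem Row.env_24 : r.env 24 = r.env 23 ^ r.m := by
  rw [env_step r 3 (by norm_num) r.iMZM rfl (varsBelow_rpow rfl _)]
  simp [Row.iMZM, eval_rpow, RExpr.eval]

/-- 25: `M = (Σ|cᵢ|/π)·ζ⁺(m+1)·(m/ζ*)^m`. [this cell, THETA-CERT-cc6 D1] -/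
theorem Row.env_25 : r.env 25 = ((r.csum : ℚ) : ℝ) * (r.vals 10)⁻¹ * ((zetaHi (r.m + 1) : ℚ) : ℝ) * r.env 24 := by
  rw [env_step r 4 (by norm_num) r.iM rfl rfl]
  simp [Row.iM, rdiv, RExpr.eval, r.env_atom]

/-- 26: `M₁ = 2qΣ|cᵢ|ζ⁺(m) · e^{2δ-η′} · (1 + ε(1 + m/ζ*)) · (m/ζ*)^m`. [this cell, THETA-CERT-cc6 D2] -/
theorem Row.env_26 : r.env 26 = ((2 * r.q * r.csum * zetaHi r.m : ℚ) : ℝ) * r.vals 14 *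
    (1 + ((r.eps : ℚ) : ℝ) * (1 + r.env 23)) * r.env 24 := by
  rw [env_step r 5 (by norm_num) r.iM1 rfl rfl]
  simp [Row.iM1, RExpr.eval, r.env_atom]

/-- 27: `A = 2/(2m+1) · M² · u₁`. [this cell, THETA-CERT-cc6 D3] -/
theorem Row.env_27 : r.env 27 = ((2 / (2 * r.m + 1) : ℚ) : ℝ) * r.env 25 ^ 2 * r.env 21 := by
  rw [env_step r 6 (by norm_num) r.iA rfl rfl]
  simp [Row.iA, RExpr.eval]

/-- 28: `‖T′‖₂⁺ = (1/2 + m/η′)·M·√(u₁/(2m+1)) + M₁·√(u₁/(2m-1))`. [this cell, THETA-CERT-cc6 D3] -/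
theorem Row.env_28 : r.env 28 = ((1 / 2 + r.m / ETA : ℚ) : ℝ) * r.env 25 * Real.sqrt (r.env 21 * ((1 / (2 * r.m + 1) : ℚ) : ℝ)) +
    r.env 26 * Real.sqrt (r.env 21 * ((1 / (2 * r.m - 1) : ℚ) : ℝ)) := by
  rw [env_step r 7 (by norm_num) r.iBin rfl rfl]
  simp [Row.iBin, RExpr.eval]

/-- 29: `B = 2·(‖T′‖₂⁺)²`. [this cell, THETA-CERT-cc6 D3] -/
theorem Row.env_29 : r.env 29 = 2 * r.env 28 ^ 2 := by
  rw [env_step r 8 (by norm_num) r.iB rfl rfl]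
  simp [Row.iB, RExpr.eval]

/-- 30: `primesC = 4Λ⁺(m+1)/(2m+1) · M² · u₁`. [this cell, THETA-CERT-cc6 D6] -/
theorem Row.env_30 : r.env 30 = ((4 * pLamHi (r.m + 1) / (2 * r.m + 1) : ℚ) : ℝ) * r.env 25 ^ 2 * r.env 21 := by
  rw [env_step r 9 (by norm_num) r.iPrimesC rfl rfl]
  simp [Row.iPrimesC, RExpr.eval]

/-- 31: `cross = 2·RS · M² · (1/m² + e^{-m/(m+1)}/(m+1))`. [this cell, THETA-CERT-cc6 D6] -/
theorem Row.env_31 : r.env 31 = ((2 * RS : ℚ) : ℝ) * (r.env 25 ^ 2 * (((1 / (r.m : ℚ) ^ 2 : ℚ) : ℝ) +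
    r.vals 16 * ((1 / ((r.m : ℚ) + 1) : ℚ) : ℝ))) := by
  rw [env_step r 10 (by norm_num) r.iCross rfl rfl]
  simp [Row.iCross, RExpr.eval, r.env_atom]

/-- 32: `J(t₀)⁺ = k log 2 + 1/2 + e^{1/2}/16 + Σ_{j≤5} e^{-(4j+1)/2}·4/(4j+1) + e^{-25/2}·(4/25)/(1 - e^{-2})`. [this cell, THETA-CERT-cc6 D7] -/
theorem Row.env_32 : r.env 32 = ((r.k : ℚ) : ℝ) * r.vals 9 + ((1 / 2 : ℚ) : ℝ) + r.vals 0 * ((1 / 16 : ℚ) : ℝ) +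
    (r.vals 1 * 4 + r.vals 2 * ((4 / 5 : ℚ) : ℝ) + r.vals 3 * ((4 / 9 : ℚ) : ℝ) + r.vals 4 * ((4 / 13 : ℚ) : ℝ) +
      r.vals 5 * ((4 / 17 : ℚ) : ℝ) + r.vals 6 * ((4 / 21 : ℚ) : ℝ) + r.vals 7 * ((4 / 25 : ℚ) : ℝ) * (1 - r.vals 8)⁻¹) := by
  rw [env_step r 11 (by norm_num) r.iJ rfl rfl]
  simp [Row.iJ, RExpr.eval, r.env_atom]

/-- 33: `archc = 2J − log 4π − γ⁻ − (π/2 + log 2)`. [this cell, THETA-CERT-cc6 D7] -/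
theorem Row.env_33 : r.env 33 = 2 * r.env 32 - r.vals 11 - ((GAMMA_LO : ℚ) : ℝ) - (r.vals 10 * ((1 / 2 : ℚ) : ℝ) + r.vals 9) := by
  rw [env_step r 12 (by norm_num) r.iArchc rfl rfl]
  simp [Row.iArchc, RExpr.eval, r.env_atom]

/-- 34: `arch = B · e^{t₀/2} · t₀²/4 + A · max(0, archc)`. [this cell, THETA-CERT-cc6 D7] -/
theorem Row.env_34 : r.env 34 = r.env 29 * r.vals 17 * ((r.t0 ^ 2 / 4 : ℚ) : ℝ) + r.env 27 * max 0 (r.env 33) := by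
  rw [env_step r 13 (by norm_num) r.iArch rfl rfl]
  simp [Row.iArch, RExpr.eval, r.env_atom]

/-- 35: `M_L = M · e^{m(2δ-η′)}`. [this cell, THETA-CERT-cc6 D4] -/
theorem Row.env_35 : r.env 35 = r.env 25 * r.vals 18 := by
  rw [env_step r 14 (by norm_num) r.iML rfl rfl]
  simp [Row.iML, RExpr.eval, r.env_atom]

/-- 36: `r̄ = 4δ h_max χ_L · e^δ · M_L + 2δχ_L² · e^δ · M_L²/√q`. [this cell, THETA-CERT-cc6 D4] -/
theorem Row.env_36 : r.env 36 = ((4 * r.delta * r.hmax * r.chiL : ℚ) : ℝ) * r.vals 13 * r.env 35 +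
    ((2 * r.delta * r.chiL ^ 2 : ℚ) : ℝ) * r.vals 13 * (r.vals 20)⁻¹ * r.env 35 ^ 2 := by
  rw [env_step r 15 (by norm_num) r.iRbar rfl rfl]
  simp [Row.iRbar, RExpr.eval, r.env_atom]

/-- 37: `atom = 2 log q/√q · r̄`. [this cell, THETA-CERT-cc6 D4/D9] -/
theorem Row.env_37 : r.env 37 = 2 * r.vals 19 * (r.vals 20)⁻¹ * r.env 36 := by
  rw [env_step r 16 (by norm_num) r.iAtom rfl rfl]
  simp [Row.iAtom, RExpr.eval, r.env_atom]

/-- 38: `loss = primesC + cross + arch + atom`. [this cell, THETA-CERT-cc6 D9] -/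
theorem Row.env_38 : r.env 38 = r.env 30 + r.env 31 + r.env 34 + r.env 37 := by
  rw [env_step r 17 (by norm_num) r.iLoss rfl rfl]
  simp [Row.iLoss, RExpr.eval]

/-- 39: `gain = 2 I_lo log q`. [this cell, THETA-CERT-cc6 D8/D9] -/
theorem Row.env_39 : r.env 39 = ((2 * r.Ilo : ℚ) : ℝ) * r.vals 19 := by
  rw [env_step r 18 (by norm_num) r.iGain rfl rfl]
  simp [Row.iGain, RExpr.eval, r.env_atom]

/-- 40: `e^{2δ} q`. [this cell, THETA-CERT-cc6 §D] -/
theorem Row.env_40 : r.env 40 = r.vals 12 * ((r.q : ℚ) : ℝ) := by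
  rw [env_step r 19 (by norm_num) r.iWin rfl rfl]
  simp [Row.iWin, RExpr.eval, r.env_atom]

/-- `loss` and `gain` are registers `38` and `39`. [this cell, THETA-CERT-cc6 D9] -/
theorem Row.loss_gain : r.loss = r.env 38 ∧ r.gain = r.env 39 := ⟨rfl, rfl⟩

end Registers

end Summit.RiemannHypothesis.RiemannHypothesis.Theorems.ThetaTier1
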